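import Mathlib
import Summits.NavierStokesRegularity.NavierStokesRegularity.Theorems.EulerZoomLiouvillePowerGaugeEulerLiouvilleSelfSimilarHighSetFlux
import Summits.NavierStokesRegularity.NavierStokesRegularity.Theorems.EulerZoomLiouvillePowerGaugeEulerLiouvilleSelfSimilarBernoulliSqueezePinchedMember
import HarnessLib

/-!
# «JETS MUST TURN» at MEMBER level — the turning law for the Bernoulli high sets of an in-class exactly self-similar member with `C²` profile
# (crux `EulerZoomLiouville.PowerGaugeEulerLiouville` = stmt-NavierStokesRegularity-19832, THE ONE STATEMENT `stub_selfSimilarC2Needle`, T2 face;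
#  line `needle_faces` stub B `stub_pressureFace` (ns-idea-11 g7); width seat ns-ezl-w1 g5)

Route №10 `EulerZoomLiouville` (NavierStokesRegularity).  The profile-level turning law `HighSetFlux.bernoulli_flux_turning_law` with its two data
hypotheses DISCHARGED from the crux hypotheses (adapted verbatim from ns-ezl-w5's `…SqueezePinchedMember` dictionary): the `A`-growth of the profile
(`Shifted.profile_energy_growth_of_gaugeA_past` + `Loc.real_growth_of_growth_le` + `HighSetFlux.setIntegral_closedBall_sq_norm_le_of_gauge`) and the
finiteness — indeed Sobolev thinness, rate `3+3ρ` — of the far high sets (`Loc.volume_bernoulliHigh_inter_far_le_sobolev_free`, growth-free).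

* **`Past.bernoulli_flux_turning_law_of_past`** — a class member (`0 < ρ ≤ ½`, `γ = 1/(2+ρ)`) whose velocity/pressure are exactly self-similar about
  `(T, x₀)` for `τ < T₁` (`T₁ ≤ 0`, `T₁ ≤ T`) with a `C²` profile `V`: for every classical pressure `P′` of `V` and every level `h` there are `C ≥ 0`, `R₂ > 0`
  such that for every `η > 0`, every layer `0 < r ≤ R` and every `R' ≥ R₂` with `R'² ≤ R(R − r)` (e.g. `R' = R − r`):
  `∫ S((ℋ_{P′}−h)/η) · (−Dθ_{R,r}[W]) ≥ −3γ · C · R'^{−(3+3ρ)}` — the smeared INFLOW flux of the (smoothed) high set `{ℋ_{P′} > h}` through the sphere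
  layer `R(R−r) ≤ |x|² ≤ R²` exceeds its OUTFLOW flux by at most `3γ C R'^{−3−3ρ}`.
* **`Loc.bernoulli_flux_turning_law_member`** — the origin-centred member (`T = T₁ = 0`, `x₀ = 0`), crux hypotheses verbatim.

READING FOR THE NEEDLE: see `…SelfSimilarHighSetFlux` — fast vortical high inflow jets (`⟪y, W y⟫ ≤ −c₁‖y‖²`) must be matched, on the same sphere
layer and inside the same high set, by OUTFLOW high points (`s < γ`: the turning heads), up to `O(R^{−3−3ρ})`.
HONEST LABEL: tool at member level; nothing here excludes a needle.  WHAT THIS IS NOT: not NS, not E — `--supports` stmt-19832 on the MODEL lattice;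
19832 OPEN; NS regularity NOT proved. [folklore; ConstantinIgnatovaVicol2026Putative §3.4.1 (3.22), §3.4.3 (3.33)]
-/

noncomputable section

-- flat `Theorems/<Route><Decl>…` files of one crux share the namespace of the crux (tree convention)
set_option linter.dupNamespace false

open MeasureTheory Set Filter Topology Metric Function InnerProductSpace
open scoped RealInnerProductSpace NNReal ENNReal

namespace Summit.NavierStokesRegularity.NavierStokesRegularity.Theorems.PowerGaugeEulerLiouville

open Literature.Analysis Literature.Analysis.FluidPDE Literature.Analysis.FunctionSpaces

namespace Past

variable {ρ T T₁ : ℝ} {x₀ : EuclideanSpace ℝ (Fin 3)}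
  {u : ℝ → EuclideanSpace ℝ (Fin 3) → EuclideanSpace ℝ (Fin 3)} {p : ℝ → EuclideanSpace ℝ (Fin 3) → ℝ}
  {H : ℝ → EuclideanSpace ℝ (Fin 3) → EuclideanSpace ℝ (Fin 3) →L[ℝ] EuclideanSpace ℝ (Fin 3)} {c : ℝ≥0}
  {V : EuclideanSpace ℝ (Fin 3) → EuclideanSpace ℝ (Fin 3)} {P : EuclideanSpace ℝ (Fin 3) → ℝ}

/-- **THE TURNING LAW FOR A PAST-EXACT MEMBER WITH `C²` PROFILE** (`0 < ρ ≤ ½`; exact self-similarity about `(T, x₀)` for `τ < T₁`, `T₁ ≤ 0`, `T₁ ≤ T`;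
distributional solution + weak gradient + the three gauges).  For every classical pressure `P′` of `V` and every level `h` there are `C ≥ 0` and `R₂ > 0`
with: for all `η > 0`, `0 < r ≤ R`, `R₂ ≤ R'`, `R'² ≤ R(R−r)`,
`−3γ·C·R'^{−(3+3ρ)} ≤ ∫ S((ℋ_{P′} x − h)/η) · (−Dθ_{R,r}(x)[γx + V x]) dx`. [folklore; ConstantinIgnatovaVicol2026Putative §3.4.1 (3.22), §3.4.3 (3.33)] -/
theorem bernoulli_flux_turning_law_of_past (hρ : 0 < ρ) (hρh : ρ ≤ 1 / 2) (hT₁ : T₁ ≤ 0) (hTT₁ : T₁ ≤ T)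
    (hsol : IsDistributionalNSSolutionOn (slab (EuclideanSpace ℝ (Fin 3)) (Iio 0) isOpen_Iio) 0 0 u p)
    (hH : HasWeakSpatialGradientOn (slab (EuclideanSpace ℝ (Fin 3)) (Iio 0) isOpen_Iio) u H)
    (hA : ∀ a : ℝ, 0 < a → ENNReal.ofReal (a ^ (2 * ρ)) *
      cknA a (0 : ℝ × EuclideanSpace ℝ (Fin 3)) u ≤ (c : ℝ≥0∞))
    (hE : ∀ a : ℝ, 0 < a → ENNReal.ofReal (a ^ ρ) *
      cknE a (0 : ℝ × EuclideanSpace ℝ (Fin 3)) H ≤ (c : ℝ≥0∞))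
    (hD : ∀ a : ℝ, 0 < a → ENNReal.ofReal (a ^ (2 * ρ)) *
      cknD a (0 : ℝ × EuclideanSpace ℝ (Fin 3)) p ≤ (c : ℝ≥0∞))
    (hu : ∀ τ : ℝ, τ < T₁ → u τ = fun x => selfSimilarCollapse (1 / (2 + ρ)) T V τ (x - x₀))
    (hp : ∀ τ : ℝ, τ < T₁ → p τ = fun x => selfSimilarCollapsePressure (1 / (2 + ρ)) T P τ (x - x₀))
    (hV : ContDiff ℝ 2 V) {P' : EuclideanSpace ℝ (Fin 3) → ℝ} (hprof : IsSelfSimilarEulerProfile (1 / (2 + ρ)) 0 V P') (h : ℝ) :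
    ∃ C R₂ : ℝ, 0 ≤ C ∧ 0 < R₂ ∧ ∀ η : ℝ, 0 < η → ∀ R r R' : ℝ, 0 < r → r ≤ R → R₂ ≤ R' → R' ^ 2 ≤ R * (R - r) →
      -(3 * (1 / (2 + ρ)) * C * R' ^ (-(3 + 3 * ρ))) ≤
        ∫ x, Real.smoothTransition ((selfSimilarBernoulli (1 / (2 + ρ)) 0 V P' x - h) / η) *
          -(fderiv ℝ (taoCutoff R r) x (selfSimilarTransport (1 / (2 + ρ)) 0 V x)) := by
  -- the dictionary, adapted from `Past.profile_eq_zero_of_pinchedVorticalChannelC2` (…SqueezePinchedMember, ns-ezl-w5 g2)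
  have hρ1' : ρ < 1 := by linarith
  have h2ρ : (0 : ℝ) < 2 + ρ := by linarith
  have hγ : (0 : ℝ) < 1 / (2 + ρ) := one_div_pos.2 h2ρ
  have hγ2 : 1 / (2 + ρ) ≤ 1 / 2 := (one_div_le_one_div_of_le two_pos (by linarith))
  have hext := Shifted.isDistributional_selfSimilarCollapse_of_past hT₁ hTT₁ x₀ hsol hu hp
  have hpmE : AEStronglyMeasurable (uncurry (selfSimilarCollapsePressure (1 / (2 + ρ)) 0 P))
      (volume.restrict (Iio (0 : ℝ) ×ˢ (univ : Set (EuclideanSpace ℝ (Fin 3))))) := by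
    have := hext.2.2.1.aestronglyMeasurable
    simpa [slab] using this
  have hPm : AEStronglyMeasurable P volume :=
    aestronglyMeasurable_pressureProfile (p := selfSimilarCollapsePressure (1 / (2 + ρ)) 0 P) hpmE fun _ _ => rfl
  have hP1 : LocallyIntegrable P volume :=
    Shifted.locallyIntegrable_pressureProfile_of_slab hγ.le (by linarith) hPm hext.2.2.1
  obtain ⟨c₀, hc₀⟩ := WeakToClassical.pressureProfile_ae_eq_add_const hext (fun _ _ => rfl) (fun _ _ => rfl) hV hP1 hprof
  obtain ⟨CA, hCA, hgrowth⟩ := Shifted.profile_energy_growth_of_gaugeA_past hρ hρh hT₁ hTT₁ x₀ hu hA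
  obtain ⟨cA, hcA, hA'⟩ := Loc.real_growth_of_growth_le hV.continuous (θ := 1 - 2 * ρ) (by linarith)
    (L₀ := 2 - T₁) (by linarith) hCA hgrowth
  have hV1 : ContDiff ℝ 1 V := hV.of_le (by norm_num)
  obtain ⟨CE, hCE, hEgr⟩ := NeedleRace.lintegral_fderiv_sq_ball_le_of_past hρ hρ1' hT₁ hTT₁ x₀ hH hu hE hV1
  obtain ⟨cE, hcE, hE'⟩ := Loc.real_growth_of_growth_le (hV1.continuous_fderiv one_ne_zero) (θ := 1 - ρ) (by linarith)
    (L₀ := 2 - T₁) (by linarith) hCE hEgr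
  have hpm : AEStronglyMeasurable (uncurry p)
      (volume.restrict (Iio (0 : ℝ) ×ˢ (univ : Set (EuclideanSpace ℝ (Fin 3))))) := by
    have := hsol.2.2.1.aestronglyMeasurable
    simpa [slab] using this
  obtain ⟨CD, hCD, hDgrowth⟩ := profile_pressure_growth_of_gaugeD_past hρ hρ1' hT₁ hTT₁ x₀ hpm hp hD
  have hD' : ∀ L : ℝ, 2 - T₁ ≤ L → ∫⁻ y in ball (0 : EuclideanSpace ℝ (Fin 3)) L, ‖P y‖ₑ ^ (3 / 2 : ℝ) ≤
      (CD.toNNReal : ℝ≥0∞) * ENNReal.ofReal (L ^ (2 - 2 * ρ)) := by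
    intro L hL; rw [ENNReal.coe_toNNReal hCD]; exact hDgrowth L hL
  -- GROWTH-FREE SOBOLEV THINNESS of the far high sets (ns-ezl-w5 g2)
  obtain ⟨C', R₂, hR₂, hthin⟩ := Loc.volume_bernoulliHigh_inter_far_le_sobolev_free hρ hprof hcA hcE hA' hE' hPm hD' hc₀ h
  -- the `A`-growth in closed-ball form
  have hAcl : ∀ L : ℝ, 1 ≤ L → ∫ x in closedBall (0 : EuclideanSpace ℝ (Fin 3)) L, ‖V x‖ ^ 2 ≤
      (2 : ℝ) ^ (1 - 2 * ρ) * cA * L ^ (1 - 2 * ρ) := fun L hL =>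
    HighSetFlux.setIntegral_closedBall_sq_norm_le_of_gauge hV.continuous hcA hA' hL
  refine ⟨max C' 0, R₂, le_max_right _ _, hR₂, fun η hη R r R' hr hrR hR' hR'sq => ?_⟩
  have hR'0 : 0 < R' := hR₂.trans_le hR'
  -- the far high set beyond the layer core is inside `{R' ≤ ‖x‖}`, hence of finite (thin) volume
  have hsub : {x : EuclideanSpace ℝ (Fin 3) | h < selfSimilarBernoulli (1 / (2 + ρ)) 0 V P' x} ∩ {x | R * (R - r) ≤ ‖x‖ ^ 2} ⊆
      {x : EuclideanSpace ℝ (Fin 3) | h < selfSimilarBernoulli (1 / (2 + ρ)) 0 V P' x} ∩ {x | R' ≤ ‖x‖} := by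
    rintro x ⟨hx, hxR⟩
    refine ⟨hx, ?_⟩
    have h2 : R' ^ 2 ≤ ‖x‖ ^ 2 := hR'sq.trans hxR
    exact (pow_le_pow_iff_left₀ hR'0.le (norm_nonneg x) two_ne_zero).1 h2
  have hvol := (measure_mono hsub).trans (hthin R' hR')
  have hfin : volume ({x : EuclideanSpace ℝ (Fin 3) | h < selfSimilarBernoulli (1 / (2 + ρ)) 0 V P' x} ∩ {x | R * (R - r) ≤ ‖x‖ ^ 2}) < ∞ :=
    hvol.trans_lt ENNReal.ofReal_lt_top
  have hlaw := HighSetFlux.bernoulli_flux_turning_law hprof hγ.le hγ2 (θA := 1 - 2 * ρ) (by linarith) hAcl h hη hr hrR hfin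
  have hvr : (volume ({x : EuclideanSpace ℝ (Fin 3) | h < selfSimilarBernoulli (1 / (2 + ρ)) 0 V P' x} ∩ {x | R * (R - r) ≤ ‖x‖ ^ 2})).toReal ≤
      max C' 0 * R' ^ (-(3 + 3 * ρ)) := by
    refine ENNReal.toReal_le_of_le_ofReal (by positivity) (hvol.trans (ENNReal.ofReal_le_ofReal ?_))
    exact mul_le_mul_of_nonneg_right (le_max_left _ _) (Real.rpow_nonneg hR'0.le _)
  have h3 : 3 * (1 / (2 + ρ)) *
      (volume ({x : EuclideanSpace ℝ (Fin 3) | h < selfSimilarBernoulli (1 / (2 + ρ)) 0 V P' x} ∩ {x | R * (R - r) ≤ ‖x‖ ^ 2})).toReal ≤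
      3 * (1 / (2 + ρ)) * (max C' 0 * R' ^ (-(3 + 3 * ρ))) := mul_le_mul_of_nonneg_left hvr (by positivity)
  linarith

end Past

/-! ### The origin-centred member -/

/-- **THE TURNING LAW FOR AN EXACTLY SELF-SIMILAR MEMBER WITH `C²` PROFILE** (crux hypotheses verbatim, `0 < ρ ≤ ½`, `γ = 1/(2+ρ)`; exact
self-similarity about the origin; `V ∈ C²`): for every classical pressure `P′` and level `h` there are `C ≥ 0`, `R₂ > 0` such that for all `η > 0`,
`0 < r ≤ R`, `R₂ ≤ R'`, `R'² ≤ R(R−r)`:  `∫ S((ℋ_{P′}−h)/η)·(−Dθ_{R,r}[W]) ≥ −3γ·C·R'^{−(3+3ρ)}` — inflow flux of the high set through every far sphere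
layer ≤ outflow flux + `3γ C R'^{−3−3ρ}`. [folklore; ConstantinIgnatovaVicol2026Putative §3.4.1 (3.22), §3.4.3 (3.33)] -/
theorem Loc.bernoulli_flux_turning_law_member {ρ : ℝ} (hρ : 0 < ρ) (hρ1 : ρ ≤ 1 / 2)
    {u : ℝ → EuclideanSpace ℝ (Fin 3) → EuclideanSpace ℝ (Fin 3)} {p : ℝ → EuclideanSpace ℝ (Fin 3) → ℝ}
    {H : ℝ → EuclideanSpace ℝ (Fin 3) → EuclideanSpace ℝ (Fin 3) →L[ℝ] EuclideanSpace ℝ (Fin 3)} {c : ℝ≥0}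
    (hsw : IsSuitableWeakSolutionOn (slab (EuclideanSpace ℝ (Fin 3)) (Iio 0) isOpen_Iio) 0 0 u p)
    (hH : HasWeakSpatialGradientOn (slab (EuclideanSpace ℝ (Fin 3)) (Iio 0) isOpen_Iio) u H)
    (hgauge : ∀ a : ℝ, 0 < a →
      ENNReal.ofReal (a ^ (2 * ρ)) * cknA a (0 : ℝ × EuclideanSpace ℝ (Fin 3)) u +
          ENNReal.ofReal (a ^ ρ) * cknE a (0 : ℝ × EuclideanSpace ℝ (Fin 3)) H +
        ENNReal.ofReal (a ^ (2 * ρ)) * cknD a (0 : ℝ × EuclideanSpace ℝ (Fin 3)) p ≤ (c : ℝ≥0∞))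
    {V : EuclideanSpace ℝ (Fin 3) → EuclideanSpace ℝ (Fin 3)} {P : EuclideanSpace ℝ (Fin 3) → ℝ}
    (hu : ∀ τ : ℝ, τ < 0 → u τ = selfSimilarCollapse (1 / (2 + ρ)) 0 V τ)
    (hp : ∀ τ : ℝ, τ < 0 → p τ = selfSimilarCollapsePressure (1 / (2 + ρ)) 0 P τ)
    (hV : ContDiff ℝ 2 V) {P' : EuclideanSpace ℝ (Fin 3) → ℝ} (hprof : IsSelfSimilarEulerProfile (1 / (2 + ρ)) 0 V P') (h : ℝ) :
    ∃ C R₂ : ℝ, 0 ≤ C ∧ 0 < R₂ ∧ ∀ η : ℝ, 0 < η → ∀ R r R' : ℝ, 0 < r → r ≤ R → R₂ ≤ R' → R' ^ 2 ≤ R * (R - r) →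
      -(3 * (1 / (2 + ρ)) * C * R' ^ (-(3 + 3 * ρ))) ≤
        ∫ x, Real.smoothTransition ((selfSimilarBernoulli (1 / (2 + ρ)) 0 V P' x - h) / η) *
          -(fderiv ℝ (taoCutoff R r) x (selfSimilarTransport (1 / (2 + ρ)) 0 V x)) := by
  have hA : ∀ a : ℝ, 0 < a → ENNReal.ofReal (a ^ (2 * ρ)) *
      cknA a (0 : ℝ × EuclideanSpace ℝ (Fin 3)) u ≤ (c : ℝ≥0∞) :=
    fun a ha => le_trans (le_trans le_self_add le_self_add) (hgauge a ha)
  have hE : ∀ a : ℝ, 0 < a → ENNReal.ofReal (a ^ ρ) *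
      cknE a (0 : ℝ × EuclideanSpace ℝ (Fin 3)) H ≤ (c : ℝ≥0∞) :=
    fun a ha => le_trans (le_trans le_add_self le_self_add) (hgauge a ha)
  have hD : ∀ a : ℝ, 0 < a → ENNReal.ofReal (a ^ (2 * ρ)) *
      cknD a (0 : ℝ × EuclideanSpace ℝ (Fin 3)) p ≤ (c : ℝ≥0∞) :=
    fun a ha => le_trans le_add_self (hgauge a ha)
  have hu' : ∀ τ : ℝ, τ < 0 → u τ = fun x => selfSimilarCollapse (1 / (2 + ρ)) 0 V τ (x - 0) := fun τ hτ => by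
    rw [hu τ hτ]; funext x; rw [sub_zero]
  have hp' : ∀ τ : ℝ, τ < 0 → p τ = fun x => selfSimilarCollapsePressure (1 / (2 + ρ)) 0 P τ (x - 0) := fun τ hτ => by
    rw [hp τ hτ]; funext x; rw [sub_zero]
  exact Past.bernoulli_flux_turning_law_of_past hρ hρ1 le_rfl le_rfl hsw.distributional hH hA hE hD hu' hp' hV hprof h

end Summit.NavierStokesRegularity.NavierStokesRegularity.Theorems.PowerGaugeEulerLiouville

end
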